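import Summits.HubbardSuperconductivity.HubbardSuperconductivity.Theorems.LiebTwinTwinOnsiteCondensationMajorantTransfer
import Summits.HubbardSuperconductivity.HubbardSuperconductivity.Theorems.LiebTwinTwinOnsiteCondensationTwinPairOrderIdentity

/-!
# Route `LiebTwin`, crux `TwinOnsiteCondensation` (stmt-HubbardSuperconductivity-15258), line `majorant`:
# the on-site pair order of a Lieb vector and Yang's cap on the co-twin factor (helper, `--supports`)

For a matrix `V` on the `(m+1)`-subsets of the torus `Λ_L = (ℤ/Lℤ)²` and the rectangular spinless
annihilators `a_x` from `(m+1)`- to `m`-subsets (`Matrix.submatrix` of `annihilation x`):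

* `re_expect_pairField_sWave_liebVec_eq` — `F_s(liebVec (m+1) V) = 2 Σ_{γ,δ} |(Σ_x a_x V a_xᵀ)_{γδ}|²`
  (`Δ_s = pairField sWave L = -√2 · O_1`, `O_1 = Σ_x c_{x↓} c_{x↑}`, and the Lieb transfer of the pairing
  channel `expect_pairChannel_eq` of the tree with kernel `G = 1`);
* `sum_norm_sq_configPair_le` — for HERMITIAN `B`: `Σ_{γ,δ} |(Σ_x a_x B a_xᵀ)_{γδ}|² ≤ (m+1)(L² - m)·Tr(BᴴB)`
  (Yang's bound, through the tree's twin pair-order identity `expect_pairField_sWave_liebVec_eq`: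
  `F_s(liebVec B) = 2n(L²-n+1)Tr(BᴴB) - (defect ≥ 0)`, `n = m+1`).

Sources: C. N. Yang, Rev. Mod. Phys. **34** (1962) 694, §4 and PRL **63** (1989) 2144 (the bound
`⟨η†η⟩ ≤ n(M-n+1)`); E. H. Lieb, PRL **62** (1989) 1201, proof of Theorem 1 (Lieb coordinates). Everything is
bookkeeping over the tree; no definition and no named fact is introduced.
-/

-- the mandated namespace `Summit.<Summit>.<Problem>.Theorems` repeats `HubbardSuperconductivity`
-- (single-problem summit, D-0017), which the `dupNamespace` linter flags on every declaration
set_option linter.dupNamespace false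

noncomputable section

namespace Summit.HubbardSuperconductivity.HubbardSuperconductivity.Theorems.LiebTwinMajorant

open Matrix Finset Literature.MathematicalPhysics.QuantumLattice
open scoped ComplexOrder

/-! ### Small algebra -/

section Algebra

/-- The kernel `G = 1` selects the diagonal: `Σ_x Σ_y 1_{xy} • f x y = Σ_x f x x`. [folklore] -/
theorem sum_sum_one_apply_smul {Λ M : Type*} [Fintype Λ] [DecidableEq Λ] [AddCommMonoid M] [Module ℂ M]
    (f : Λ → Λ → M) : ∑ x, ∑ y, (1 : Matrix Λ Λ ℂ) x y • f x y = ∑ x, f x x := by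
  refine Finset.sum_congr rfl fun x _ => ?_
  simp only [Matrix.one_apply, ite_smul, one_smul, zero_smul]
  rw [Finset.sum_ite_eq]
  simp

/-- `⟨ψ, (cO)ᴴ (cO) ψ⟩ = c̄ c ⟨ψ, Oᴴ O ψ⟩`. [folklore] -/
theorem expect_smul_conjTranspose_mul_smul {ι : Type*} [LinearOrder ι] [Fintype ι] (c : ℂ)
    (O : Matrix (Finset ι) (Finset ι) ℂ) (ψ : Fock ι) :
    expect ((c • O)ᴴ * (c • O)) ψ = star c * c * expect (Oᴴ * O) ψ := by
  rw [Literature.MathematicalPhysics.QuantumLattice.expect, Literature.MathematicalPhysics.QuantumLattice.expect,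
    conjTranspose_smul, Matrix.smul_mul, Matrix.mul_smul, smul_smul, Matrix.smul_mulVec, dotProduct_smul,
    smul_eq_mul]

end Algebra

/-! ### The on-site pair field as a pairing channel with kernel `1` -/

section Torus

variable {L : ℕ} [NeZero L]

/-- `Δ_s = -√2 · O_1`, `O_1 = Σ_x Σ_y 1_{xy} • c_{y↓} c_{x↑} = Σ_x c_{x↓} c_{x↑}` (`c_{x↑} c_{x↓} = -c_{x↓} c_{x↑}`).
Scalapino, Phys. Rep. 250 (1995) 329, §2. [folklore] -/
theorem pairField_sWave_eq_neg_smul_pairChannel_one :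
    pairField sWave L = (-((Real.sqrt 2 : ℝ) : ℂ)) •
      ∑ x : FermionTorus 2 L, ∑ y : FermionTorus 2 L, (1 : Matrix (FermionTorus 2 L) (FermionTorus 2 L) ℂ) x y •
        (annihilation (orb y 1) * annihilation (orb x 0) :
          Matrix (Finset (Orb (FermionTorus 2 L))) (Finset (Orb (FermionTorus 2 L))) ℂ) := by
  rw [sum_sum_one_apply_smul (f := fun x y : FermionTorus 2 L =>
      (annihilation (orb y 1) * annihilation (orb x 0) :
        Matrix (Finset (Orb (FermionTorus 2 L))) (Finset (Orb (FermionTorus 2 L))) ℂ)),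
    LiebTwinTwin.pairField_sWave_eq_smul_sum, neg_smul, ← smul_neg, ← Finset.sum_neg_distrib]
  congr 1
  refine Finset.sum_congr rfl fun x _ => ?_
  exact LiebThm1.annihilation_mul_annihilation_eq_neg _ _

/-- **On-site pair order of a Lieb vector.** For every matrix `V` on the `(m+1)`-subsets of the torus,
`F_s(liebVec (m+1) V) = Re⟨liebVec V, Δ_sᴴ Δ_s liebVec V⟩ = 2 Σ_{γ,δ} |(Σ_x a_x V a_xᵀ)_{γδ}|²` with the
rectangular spinless annihilators `a_x` (the Lieb transfer of `O_1 = Σ_x c_{x↓}c_{x↑}`, `Δ_s = -√2 O_1`).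
Lieb, PRL 62 (1989) 1201, proof of Theorem 1; Yang, PRL 63 (1989) 2144. [folklore] -/
theorem re_expect_pairField_sWave_liebVec_eq (m : ℕ)
    (V : Matrix (Config (FermionTorus 2 L) (m + 1)) (Config (FermionTorus 2 L) (m + 1)) ℂ) :
    (expect ((pairField sWave L)ᴴ * pairField sWave L) (liebVec (m + 1) V)).re =
      2 * ∑ γ : Config (FermionTorus 2 L) m, ∑ δ : Config (FermionTorus 2 L) m,
        ‖(∑ x : FermionTorus 2 L,
            (annihilation x).submatrix (Subtype.val : Config (FermionTorus 2 L) m → Finset (FermionTorus 2 L))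
                (Subtype.val : Config (FermionTorus 2 L) (m + 1) → Finset (FermionTorus 2 L)) * V *
              ((annihilation x).submatrix (Subtype.val : Config (FermionTorus 2 L) m → Finset (FermionTorus 2 L))
                (Subtype.val : Config (FermionTorus 2 L) (m + 1) → Finset (FermionTorus 2 L)))ᵀ) γ δ‖ ^ 2 := by
  rw [pairField_sWave_eq_neg_smul_pairChannel_one, expect_smul_conjTranspose_mul_smul,
    expect_pairChannel_eq (isInSector_liebVec (m + 1) V)]
  simp_rw [LiebThm1.liebW_liebVec, sum_sum_one_apply_smul]
  have h2 : star (-((Real.sqrt 2 : ℝ) : ℂ)) * (-((Real.sqrt 2 : ℝ) : ℂ)) = ((2 : ℝ) : ℂ) := by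
    rw [star_neg, neg_mul_neg, Complex.star_def, Complex.conj_ofReal, ← Complex.ofReal_mul,
      Real.mul_self_sqrt (by norm_num : (0 : ℝ) ≤ 2)]
  rw [h2, ← Complex.ofReal_mul, Complex.ofReal_re]

/-- **Yang's cap on the pair order of a Hermitian Lieb matrix (the co-twin factor).** For Hermitian `B` on
the `(m+1)`-subsets of the torus of side `L`:
`Σ_{γ,δ} |(Σ_x a_x B a_xᵀ)_{γδ}|² ≤ (m+1)(L² - m) · Re Tr(BᴴB)` (`= n(L²-n+1) Tr B²`, `n = m+1`), from the twin
pair-order identity `F_s(liebVec B) = 2n(L²-n+1)Tr(BᴴB) - Σ‖[B, c†_y c_x]‖²_F`.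
Yang, Rev. Mod. Phys. 34 (1962) 694, §4; Yang, PRL 63 (1989) 2144; Lieb, PRL 62 (1989) 1201. [folklore] -/
theorem sum_norm_sq_configPair_le :
    ∀ (L : ℕ) [NeZero L] (m : ℕ)
      (B : Matrix (Config (FermionTorus 2 L) (m + 1)) (Config (FermionTorus 2 L) (m + 1)) ℂ), Bᴴ = B →
      ∑ γ : Config (FermionTorus 2 L) m, ∑ δ : Config (FermionTorus 2 L) m,
          ‖(∑ x : FermionTorus 2 L,
              (annihilation x).submatrix (Subtype.val : Config (FermionTorus 2 L) m → Finset (FermionTorus 2 L))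
                  (Subtype.val : Config (FermionTorus 2 L) (m + 1) → Finset (FermionTorus 2 L)) * B *
                ((annihilation x).submatrix (Subtype.val : Config (FermionTorus 2 L) m → Finset (FermionTorus 2 L))
                  (Subtype.val : Config (FermionTorus 2 L) (m + 1) → Finset (FermionTorus 2 L)))ᵀ) γ δ‖ ^ 2 ≤
        ((m : ℝ) + 1) * ((L : ℝ) ^ 2 - m) * ((Bᴴ * B).trace).re := by
  intro L _ m B hB
  have h1 := re_expect_pairField_sWave_liebVec_eq m B
  rw [LiebTwinTwin.expect_pairField_sWave_liebVec_eq (m + 1) hB, Complex.sub_re] at h1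
  have hcoef : (2 * (((m + 1 : ℕ) : ℂ) * ((L : ℂ) ^ 2 - ((m + 1 : ℕ) : ℂ) + 1))) =
      ((2 * (((m : ℝ) + 1) * ((L : ℝ) ^ 2 - m)) : ℝ) : ℂ) := by
    push_cast
    ring
  rw [hcoef, Complex.re_ofReal_mul] at h1
  have hdef : 0 ≤ (∑ x : FermionTorus 2 L, ∑ y : FermionTorus 2 L,
      ((B * configHop (m + 1) y x - configHop (m + 1) y x * B)ᴴ *
        (B * configHop (m + 1) y x - configHop (m + 1) y x * B)).trace).re := by
    rw [Complex.re_sum]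
    refine Finset.sum_nonneg fun x _ => ?_
    rw [Complex.re_sum]
    exact Finset.sum_nonneg fun y _ => LiebTwinTwin.trace_conjTranspose_mul_self_re_nonneg _
  nlinarith [h1, hdef]

end Torus

end Summit.HubbardSuperconductivity.HubbardSuperconductivity.Theorems.LiebTwinMajorant

end
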